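import Literature.AnabelianGeometry.SemiGraphs.TemperedReconstructionR3Sub
import Literature.AnabelianGeometry.SemiGraphs.TemperedReconstructionR3cProofs
import Literature.AnabelianGeometry.SemiGraphs.TemperedFunctorialityWithHom
import Literature.AnabelianGeometry.SemiGraphs.TemperedReconstructionR3aProofs
import HarnessLib

/-!
# Semi-graphs of anabelioids, §3, Corollary 3.9 step (R3): the sub-DAG closed up — (R3c) as the named
# statement, and (R3) as an equivalence modulo the leaves

Mochizuki, *Semi-graphs of anabelioids*, Publ. RIMS **42** (2006), §3, Corollary 3.9, proof p. 43
ll. 6–14 [cite: MochizukiSemiAnbd2006, Cor 3.9 p.43].  PROOF-ONLY companion (no definitions) of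
`TemperedReconstructionR3Sub.lean` (abc-iut-w4-d080):

* `edgeLikeCentralizer_of` / `edgeLikeCentralizer_of_compactInVerticial` — the named sub-node (R3c)
  `EdgeLikeCentralizer` from Thm. 3.7 (i)–(iii) + `EdgeLikeIsInfVerticial`, resp. from (iii)
  `CompactInVerticial` alone (the other inputs being the tree's `verticialInjective_holds`,
  `verticialDistinct_holds`, `edgeLikeIsInfVerticial_of`) — i.e. `TemperedReconstructionR3cProofs.lean`
  packaged at the named statement;
* `Hom.compat_of_chartPullbackWith_iso` — (R1) for every family `θ`: a homomorphism inducing `F^*_θ` is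
  compatible with `F` on the verticial and edge homomorphisms (abc-iut-L3-t10's
  `conj_of_chartPullbackWith_iso` / `_edge`, repackaged as `CompatV ∧ CompatE`);
* `compatible_iff_exists_chartPullbackWith_iso` — hence, modulo (R3a) `TwistAbsorption` and (R3c),
  "compatible up to conjugation with `F`" ⟺ "induces `F^*_θ` for some `θ`" (step (R3) is exactly the
  missing implication);
* `chartPullbackWith_iso_of_compatible` / `compatible_iff_exists_chartPullbackWith_iso'` — with
  abc-iut-w4-d064's `twistAbsorption_holds` ((R3a) PROVED, `TemperedReconstructionR3aProofs.lean`):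
  **step (R3) of Cor. 3.9 in the `∃ θ` form holds MODULO Thm. 3.7 (iii) `CompactInVerticial` ONLY.**

Nothing here takes a side on [IUTchIII] Cor. 3.12; typed ≠ proved for the leaf (R3a).
-/

noncomputable section

open CategoryTheory Topology

namespace Literature.AnabelianGeometry.SemiGraphs

namespace ProfiniteSemiGraph

universe u

variable {𝒢 ℋ : ProfiniteSemiGraph.{u}}

/-! ### (R3c) at the named statement -/

/-- **(R3c) `EdgeLikeCentralizer` from Thm. 3.7 (i), (ii), (iii) and `EdgeLikeIsInfVerticial`**
(`centralizer_map_le_of_mem_verticialSubgroups`, `TemperedReconstructionR3cProofs.lean`).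
[cite: MochizukiSemiAnbd2006, Cor 3.9 p.43] -/
theorem edgeLikeCentralizer_of (hCV : CompactInVerticial.{u}) (hVD : VerticialDistinct.{u})
    (hVI : VerticialInjective.{u}) (hEIV : EdgeLikeIsInfVerticial.{u}) : EdgeLikeCentralizer.{u} :=
  fun _ hℋ c e ψ hψ U hU v H hH hUH =>
    centralizer_map_le_of_mem_verticialSubgroups hCV hVD hVI hEIV hℋ c e ψ hψ U hU v H hH hUH

/-- **(R3c) `EdgeLikeCentralizer` modulo Thm. 3.7 (iii) `CompactInVerticial` only** (the tree's
`verticialInjective_holds`, `verticialDistinct_holds`, `edgeLikeIsInfVerticial_of` plugged in).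
[cite: MochizukiSemiAnbd2006, Cor 3.9 p.43] -/
theorem edgeLikeCentralizer_of_compactInVerticial (hCV : CompactInVerticial.{u}) :
    EdgeLikeCentralizer.{u} :=
  fun _ hℋ c e ψ hψ U hU v H hH hUH =>
    centralizer_map_le_of_mem_verticialSubgroups_of_compactInVerticial hCV hℋ c e ψ hψ U hU v H hH hUH

/-! ### (R1) for every family of conjugating elements, and (R3) as an `iff` -/

namespace Hom

/-- (R1) for every family `θ` ([SemiAnbd] Prop. 3.6 (iv) p. 39, Thm. 3.7 (i) p. 40, (iii) p. 41): a
homomorphism inducing `F^*_θ` is compatible with `F` on the verticial and on the edge homomorphisms —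
abc-iut-L3-t10's `conj_of_chartPullbackWith_iso` / `_edge`, repackaged as `CompatV ∧ CompatE`.
[cite: MochizukiSemiAnbd2006, Prop 3.6(iv) p.39] -/
theorem compat_of_chartPullbackWith_iso (F : Hom 𝒢 ℋ) (θ : F.ConjugatorFamily)
    (c𝒢 : TemperedPiChart 𝒢) (cℋ : TemperedPiChart ℋ) (φ : c𝒢.G →ₜ* cℋ.G)
    (h : Nonempty (F.chartPullbackWith θ c𝒢 cℋ ≅ BTemp.res φ)) :
    F.CompatV c𝒢 cℋ φ ∧ F.CompatE c𝒢 cℋ φ :=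
  ⟨fun v ψ ψ' hψ hψ' => F.conj_of_chartPullbackWith_iso θ c𝒢 cℋ φ h v ψ ψ' hψ hψ',
    fun e ψ ψ' hψ hψ' => F.conj_of_chartPullbackWith_iso_edge θ c𝒢 cℋ φ h e ψ ψ' hψ hψ'⟩

end Hom

/-- **(R3) is an equivalence modulo the leaves (R3a), (R3c)**: under the hypotheses of [SemiAnbd]
Cor. 3.9, for a locally open `F`, "`φ` is compatible up to conjugation with `F` on the verticial and
edge homomorphisms" iff "`φ` induces `F^*_θ` for some family `θ` of conjugating elements" — `⇐` is (R1)
for every `θ`, `⇒` is (R3a) fed with (R3c). [cite: MochizukiSemiAnbd2006, Cor 3.9 p.43] -/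
theorem compatible_iff_exists_chartPullbackWith_iso (hR3c : EdgeLikeCentralizer.{u})
    (hR3a : TwistAbsorption.{u}) (h𝒢 : Cor39Hypotheses 𝒢) (hℋ : Cor39Hypotheses ℋ)
    (c𝒢 : TemperedPiChart 𝒢) (cℋ : TemperedPiChart ℋ) (F : Hom 𝒢 ℋ) (φ : c𝒢.G →ₜ* cℋ.G)
    (hF : F.IsLocallyOpen) :
    (F.CompatV c𝒢 cℋ φ ∧ F.CompatE c𝒢 cℋ φ) ↔
      ∃ θ : F.ConjugatorFamily, Nonempty (F.chartPullbackWith θ c𝒢 cℋ ≅ BTemp.res φ) :=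
  ⟨fun h => chartPullbackWith_iso_of_compatible_of_subs hR3c hR3a h𝒢 hℋ c𝒢 cℋ F φ hF h.1 h.2,
    fun ⟨θ, h⟩ => F.compat_of_chartPullbackWith_iso θ c𝒢 cℋ φ h⟩

/-- **(R3) modulo (R3a) and Thm. 3.7 (iii)**: with (R3c) discharged up to `CompactInVerticial`, the
`∃ θ` form of step (R3) of Cor. 3.9 follows from the single sub-node `TwistAbsorption` and the single
named fact `CompactInVerticial`. [cite: MochizukiSemiAnbd2006, Cor 3.9 p.43] -/
theorem chartPullbackWith_iso_of_compatible_of_twistAbsorption (hCV : CompactInVerticial.{u})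
    (hR3a : TwistAbsorption.{u}) (h𝒢 : Cor39Hypotheses 𝒢) (hℋ : Cor39Hypotheses ℋ)
    (c𝒢 : TemperedPiChart 𝒢) (cℋ : TemperedPiChart ℋ) (F : Hom 𝒢 ℋ) (φ : c𝒢.G →ₜ* cℋ.G)
    (hF : F.IsLocallyOpen) (hV : F.CompatV c𝒢 cℋ φ) (hE : F.CompatE c𝒢 cℋ φ) :
    ∃ θ : F.ConjugatorFamily, Nonempty (F.chartPullbackWith θ c𝒢 cℋ ≅ BTemp.res φ) :=
  chartPullbackWith_iso_of_compatible_of_subs (edgeLikeCentralizer_of_compactInVerticial hCV) hR3a h𝒢 hℋ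
    c𝒢 cℋ F φ hF hV hE

/-! ### Step (R3) of Corollary 3.9, `∃ θ` form, modulo Theorem 3.7 (iii) only -/

/-- **[SemiAnbd] Cor. 3.9, step (R3) ("`φ` arises from a morphism of graphs of anabelioids", p. 43
ll. 12–13), `∃ θ` form, MODULO Thm. 3.7 (iii) `CompactInVerticial` ONLY**: for `G`, `H` as in
Corollary 3.9, every continuous `φ : π₁^temp(G) → π₁^temp(H)` compatible up to conjugation with a
locally open `F : G → H` on the verticial and edge homomorphisms induces the pull-back functor `F^*_θ`
for some family `θ` of conjugating elements — (R3a) `twistAbsorption_holds` (abc-iut-w4-d064) fed with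
(R3c) `edgeLikeCentralizer_of_compactInVerticial` (abc-iut-w4-d080) through the composition of
`TemperedReconstructionR3Sub.lean`. [cite: MochizukiSemiAnbd2006, Cor 3.9 p.43] -/
theorem chartPullbackWith_iso_of_compatible (hCV : CompactInVerticial.{u}) (h𝒢 : Cor39Hypotheses 𝒢)
    (hℋ : Cor39Hypotheses ℋ) (c𝒢 : TemperedPiChart 𝒢) (cℋ : TemperedPiChart ℋ) (F : Hom 𝒢 ℋ)
    (φ : c𝒢.G →ₜ* cℋ.G) (hF : F.IsLocallyOpen) (hV : F.CompatV c𝒢 cℋ φ) (hE : F.CompatE c𝒢 cℋ φ) :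
    ∃ θ : F.ConjugatorFamily, Nonempty (F.chartPullbackWith θ c𝒢 cℋ ≅ BTemp.res φ) :=
  chartPullbackWith_iso_of_compatible_of_twistAbsorption hCV twistAbsorption_holds h𝒢 hℋ c𝒢 cℋ F φ hF
    hV hE

/-- **Cor. 3.9, step (R3) as an `iff`, modulo Thm. 3.7 (iii) only**: for locally open `F`, "compatible
up to conjugation on the verticial and edge homomorphisms" ⟺ "induces `F^*_θ` for some `θ`".
[cite: MochizukiSemiAnbd2006, Cor 3.9 p.43] -/
theorem compatible_iff_exists_chartPullbackWith_iso' (hCV : CompactInVerticial.{u})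
    (h𝒢 : Cor39Hypotheses 𝒢) (hℋ : Cor39Hypotheses ℋ) (c𝒢 : TemperedPiChart 𝒢)
    (cℋ : TemperedPiChart ℋ) (F : Hom 𝒢 ℋ) (φ : c𝒢.G →ₜ* cℋ.G) (hF : F.IsLocallyOpen) :
    (F.CompatV c𝒢 cℋ φ ∧ F.CompatE c𝒢 cℋ φ) ↔
      ∃ θ : F.ConjugatorFamily, Nonempty (F.chartPullbackWith θ c𝒢 cℋ ≅ BTemp.res φ) :=
  compatible_iff_exists_chartPullbackWith_iso (edgeLikeCentralizer_of_compactInVerticial hCV)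
    twistAbsorption_holds h𝒢 hℋ c𝒢 cℋ F φ hF

end ProfiniteSemiGraph

end Literature.AnabelianGeometry.SemiGraphs

end
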